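import Summits.Ventures.YMGap.Thresholds.HaarFourthMoment
import HarnessLib

/-!
# The Haar SIXTH moment of the `SU(2)` character: `∫ (Re tr U)⁶ dU = 5`, i.e. `E[(½ Re tr U_p)⁶] = 5/64`
# (row type C-PRESS, endpoint `β = 0`, part 17: the Catalan moments `1, 2, 5` of orders `2, 4, 6`)

Cell `pub-ymgap`, seat ds-1 (gen 11). HONEST FRAMING: pure compact-group integration for a compact group `G ≅ SU(2)`
(`IsSpecialUnitaryModel ρ`); nothing lattice-specific, nothing about the continuum or the Clay problem. Kernel theorems only,
0 compute, no definitions.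

Same method as part 10 (`HaarFourthMoment`), one degree up. With the unit quaternion `x = (Re U₀₀, Im U₀₀, Re U₀₁, Im U₀₁)` of the
first row and `m₆ := ∫ x₀⁶`: the twists `q = i, j, k` give `∫ x_a⁶ = m₆` and the SWAP `∫ x₀² x_a⁴ = ∫ x₀⁴ x_a²`; the rotations
`q = (3 ± 4e_a)/5` give `∫((3x₀ ∓ 4x_a)/5)⁶ = m₆`, and adding the two signs:
`1458 m₆ + 38880 ∫x₀⁴x_a² + 69120 ∫x₀²x_a⁴ + 8192 m₆ = 31250 m₆`, i.e. **`∫ x₀⁴ x_a² = m₆/5`**; finally the unitarity row sum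
multiplied by `x₀⁴`: `m₆ + 3·(m₆/5) = ∫ x₀⁴ = 1/8` (part 10), hence ★ **`m₆ = 5/64`** (`integral_re00_pow_six`) and
★★ **`∫ (Re tr ρ(g))⁶ dg = 64 m₆ = 5`** (`integral_reTr_pow_six`) — the Catalan number `C₃`, the number of invariants in `V^{⊗6}`,
the sixth moment of the Sato–Tate law; also `∫ (Re tr)⁵ = 0`. So the even moments of `Re tr U` under `SU(2)` Haar measure of orders
`2, 4, 6` are `1, 2, 5` (`charVariance_eq_one`, part 10, this file), all without Weyl integration. USE: the sixth cumulant of the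
plaquette variable `W = ½ Re tr U` at `β = 0` is `κ₆ = m₆ − 15 m₄ m₂ + 30 m₂³ = 5/64 − 15/32 + 30/64 = 5/64` … (input of the sixth
BDI coefficient; not drawn here). References: Balian–Drouffe–Itzykson, Phys. Rev. D 11 (1975) 2104 §III; T. Bröcker, T. tom Dieck,
GTM 98 (1985) II §5. Everything here is proved. [folklore]
-/

noncomputable section

open MeasureTheory Complex
open Literature.MathematicalPhysics.QuantumLattice Literature.MathematicalPhysics.QuantumFieldTheory
open scoped Quaternion

namespace Summit.Ventures.YMGap.HaarSixthMoment

open Summit.Ventures.YMGap.HaarFourthMoment (integral_comp_quat continuous_coords sum_sq_eq_one reTr_eq_two_mul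
  integral_re00_pow_four)

section Model

variable {G : Type*} [Group G] [TopologicalSpace G] [IsTopologicalGroup G] [CompactSpace G]
  [MeasurableSpace G] [BorelSpace G] (ρ : G →* Matrix (Fin 2) (Fin 2) ℂ)

/-! ### Sixth moments of single coordinates and the swap `∫ x₀² x_a⁴ = ∫ x₀⁴ x_a²` (`q = i, j, k`) -/

/-- `∫ (Im U₀₀)⁶ = ∫ (Re U₀₀)⁶` and `∫ (Re U₀₀)²(Im U₀₀)⁴ = ∫ (Re U₀₀)⁴(Im U₀₀)²` (left twist by `quatMatrix i`). [folklore] -/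
theorem im00_six_and_swap (hρ : IsSpecialUnitaryModel ρ) :
    ∫ g, (ρ g 0 0).im ^ 6 ∂haarProbability G = ∫ g, (ρ g 0 0).re ^ 6 ∂haarProbability G ∧
      ∫ g, (ρ g 0 0).re ^ 2 * (ρ g 0 0).im ^ 4 ∂haarProbability G =
        ∫ g, (ρ g 0 0).re ^ 4 * (ρ g 0 0).im ^ 2 ∂haarProbability G := by
  constructor
  · have h := integral_comp_quat ρ hρ (a := 0) (b := 1) (c := 0) (d := 0) (by norm_num) (fun s _ _ _ => s ^ 6)
    have hpt : ∀ g : G, ((0 : ℝ) * (ρ g 0 0).re - 1 * (ρ g 0 0).im - 0 * (ρ g 0 1).re - 0 * (ρ g 0 1).im) ^ 6 =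
        (ρ g 0 0).im ^ 6 := fun g => by ring
    simp only [hpt] at h
    exact h
  · have h := integral_comp_quat ρ hρ (a := 0) (b := 1) (c := 0) (d := 0) (by norm_num)
      (fun s t _ _ => s ^ 4 * t ^ 2)
    have hpt : ∀ g : G, ((0 : ℝ) * (ρ g 0 0).re - 1 * (ρ g 0 0).im - 0 * (ρ g 0 1).re - 0 * (ρ g 0 1).im) ^ 4 *
        ((0 : ℝ) * (ρ g 0 0).im + 1 * (ρ g 0 0).re + 0 * (ρ g 0 1).im - 0 * (ρ g 0 1).re) ^ 2 =
        (ρ g 0 0).re ^ 2 * (ρ g 0 0).im ^ 4 := fun g => by ring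
    simp only [hpt] at h
    exact h

/-- `∫ (Re U₀₁)⁶ = ∫ (Re U₀₀)⁶` and `∫ (Re U₀₀)²(Re U₀₁)⁴ = ∫ (Re U₀₀)⁴(Re U₀₁)²` (left twist by `quatMatrix j`). [folklore] -/
theorem re01_six_and_swap (hρ : IsSpecialUnitaryModel ρ) :
    ∫ g, (ρ g 0 1).re ^ 6 ∂haarProbability G = ∫ g, (ρ g 0 0).re ^ 6 ∂haarProbability G ∧
      ∫ g, (ρ g 0 0).re ^ 2 * (ρ g 0 1).re ^ 4 ∂haarProbability G =
        ∫ g, (ρ g 0 0).re ^ 4 * (ρ g 0 1).re ^ 2 ∂haarProbability G := by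
  constructor
  · have h := integral_comp_quat ρ hρ (a := 0) (b := 0) (c := 1) (d := 0) (by norm_num) (fun s _ _ _ => s ^ 6)
    have hpt : ∀ g : G, ((0 : ℝ) * (ρ g 0 0).re - 0 * (ρ g 0 0).im - 1 * (ρ g 0 1).re - 0 * (ρ g 0 1).im) ^ 6 =
        (ρ g 0 1).re ^ 6 := fun g => by ring
    simp only [hpt] at h
    exact h
  · have h := integral_comp_quat ρ hρ (a := 0) (b := 0) (c := 1) (d := 0) (by norm_num)
      (fun s _ u _ => s ^ 4 * u ^ 2)
    have hpt : ∀ g : G, ((0 : ℝ) * (ρ g 0 0).re - 0 * (ρ g 0 0).im - 1 * (ρ g 0 1).re - 0 * (ρ g 0 1).im) ^ 4 *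
        ((0 : ℝ) * (ρ g 0 1).re - 0 * (ρ g 0 1).im + 1 * (ρ g 0 0).re + 0 * (ρ g 0 0).im) ^ 2 =
        (ρ g 0 0).re ^ 2 * (ρ g 0 1).re ^ 4 := fun g => by ring
    simp only [hpt] at h
    exact h

/-- `∫ (Im U₀₁)⁶ = ∫ (Re U₀₀)⁶` and `∫ (Re U₀₀)²(Im U₀₁)⁴ = ∫ (Re U₀₀)⁴(Im U₀₁)²` (left twist by `quatMatrix k`). [folklore] -/
theorem im01_six_and_swap (hρ : IsSpecialUnitaryModel ρ) :
    ∫ g, (ρ g 0 1).im ^ 6 ∂haarProbability G = ∫ g, (ρ g 0 0).re ^ 6 ∂haarProbability G ∧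
      ∫ g, (ρ g 0 0).re ^ 2 * (ρ g 0 1).im ^ 4 ∂haarProbability G =
        ∫ g, (ρ g 0 0).re ^ 4 * (ρ g 0 1).im ^ 2 ∂haarProbability G := by
  constructor
  · have h := integral_comp_quat ρ hρ (a := 0) (b := 0) (c := 0) (d := 1) (by norm_num) (fun s _ _ _ => s ^ 6)
    have hpt : ∀ g : G, ((0 : ℝ) * (ρ g 0 0).re - 0 * (ρ g 0 0).im - 0 * (ρ g 0 1).re - 1 * (ρ g 0 1).im) ^ 6 =
        (ρ g 0 1).im ^ 6 := fun g => by ring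
    simp only [hpt] at h
    exact h
  · have h := integral_comp_quat ρ hρ (a := 0) (b := 0) (c := 0) (d := 1) (by norm_num)
      (fun s _ _ v => s ^ 4 * v ^ 2)
    have hpt : ∀ g : G, ((0 : ℝ) * (ρ g 0 0).re - 0 * (ρ g 0 0).im - 0 * (ρ g 0 1).re - 1 * (ρ g 0 1).im) ^ 4 *
        ((0 : ℝ) * (ρ g 0 1).im + 0 * (ρ g 0 1).re - 0 * (ρ g 0 0).im + 1 * (ρ g 0 0).re) ^ 2 =
        (ρ g 0 0).re ^ 2 * (ρ g 0 1).im ^ 4 := fun g => by ring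
    simp only [hpt] at h
    exact h

/-! ### Mixed moments: `∫ x₀⁴ x_a² = (∫ x₀⁶)/5` (the rotations `q = (3 ± 4 e_a)/5`) -/

/-- The bookkeeping step: from `∫ ((3x₀ ∓ 4y)/5)⁶ = ∫ x₀⁶ = ∫ y⁶` and the swap `∫ x₀² y⁴ = ∫ x₀⁴ y²` conclude
`∫ x₀⁴ y² = (∫ x₀⁶)/5`. [folklore] -/
theorem integral_four_two_of_rotations {x y : G → ℝ} (hx : Continuous x) (hy : Continuous y)
    (hm : ∫ g, ((3 * x g - 4 * y g) / 5) ^ 6 ∂haarProbability G = ∫ g, x g ^ 6 ∂haarProbability G)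
    (hp : ∫ g, ((3 * x g + 4 * y g) / 5) ^ 6 ∂haarProbability G = ∫ g, x g ^ 6 ∂haarProbability G)
    (hy6 : ∫ g, y g ^ 6 ∂haarProbability G = ∫ g, x g ^ 6 ∂haarProbability G)
    (hsw : ∫ g, x g ^ 2 * y g ^ 4 ∂haarProbability G = ∫ g, x g ^ 4 * y g ^ 2 ∂haarProbability G) :
    ∫ g, x g ^ 4 * y g ^ 2 ∂haarProbability G = (∫ g, x g ^ 6 ∂haarProbability G) / 5 := by
  have hi1 : Integrable (fun g => ((3 * x g - 4 * y g) / 5) ^ 6) (haarProbability G) :=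
    Continuous.integrable_of_hasCompactSupport (by fun_prop) (HasCompactSupport.of_compactSpace _)
  have hi2 : Integrable (fun g => ((3 * x g + 4 * y g) / 5) ^ 6) (haarProbability G) :=
    Continuous.integrable_of_hasCompactSupport (by fun_prop) (HasCompactSupport.of_compactSpace _)
  have hi3 : Integrable (fun g => (1458 / 15625 : ℝ) * x g ^ 6) (haarProbability G) :=
    Continuous.integrable_of_hasCompactSupport (by fun_prop) (HasCompactSupport.of_compactSpace _)
  have hi4 : Integrable (fun g => (38880 / 15625 : ℝ) * (x g ^ 4 * y g ^ 2)) (haarProbability G) :=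
    Continuous.integrable_of_hasCompactSupport (by fun_prop) (HasCompactSupport.of_compactSpace _)
  have hi5 : Integrable (fun g => (69120 / 15625 : ℝ) * (x g ^ 2 * y g ^ 4)) (haarProbability G) :=
    Continuous.integrable_of_hasCompactSupport (by fun_prop) (HasCompactSupport.of_compactSpace _)
  have hi6 : Integrable (fun g => (8192 / 15625 : ℝ) * y g ^ 6) (haarProbability G) :=
    Continuous.integrable_of_hasCompactSupport (by fun_prop) (HasCompactSupport.of_compactSpace _)
  have hsum : ∫ g, (((3 * x g - 4 * y g) / 5) ^ 6 + ((3 * x g + 4 * y g) / 5) ^ 6) ∂haarProbability G =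
      2 * ∫ g, x g ^ 6 ∂haarProbability G := by
    rw [integral_add hi1 hi2, hm, hp]; ring
  have hpt : ∀ g : G, ((3 * x g - 4 * y g) / 5) ^ 6 + ((3 * x g + 4 * y g) / 5) ^ 6 =
      (1458 / 15625 : ℝ) * x g ^ 6 + (38880 / 15625 : ℝ) * (x g ^ 4 * y g ^ 2) +
        (69120 / 15625 : ℝ) * (x g ^ 2 * y g ^ 4) + (8192 / 15625 : ℝ) * y g ^ 6 := by
    intro g; ring
  simp only [hpt] at hsum
  have hi34 : Integrable (fun g => (1458 / 15625 : ℝ) * x g ^ 6 + (38880 / 15625 : ℝ) * (x g ^ 4 * y g ^ 2))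
      (haarProbability G) := hi3.add hi4
  have hi345 : Integrable (fun g => (1458 / 15625 : ℝ) * x g ^ 6 + (38880 / 15625 : ℝ) * (x g ^ 4 * y g ^ 2) +
      (69120 / 15625 : ℝ) * (x g ^ 2 * y g ^ 4)) (haarProbability G) := hi34.add hi5
  rw [integral_add hi345 hi6, integral_add hi34 hi5, integral_add hi3 hi4, integral_const_mul, integral_const_mul,
    integral_const_mul, integral_const_mul, hy6, hsw] at hsum
  linarith

/-- `∫ (Re U₀₀)⁴ (Im U₀₀)² = (∫ (Re U₀₀)⁶)/5` (rotations by `(3 ± 4i)/5`). [folklore] -/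
theorem integral_re00_four_mul_im00_sq (hρ : IsSpecialUnitaryModel ρ) :
    ∫ g, (ρ g 0 0).re ^ 4 * (ρ g 0 0).im ^ 2 ∂haarProbability G =
      (∫ g, (ρ g 0 0).re ^ 6 ∂haarProbability G) / 5 := by
  obtain ⟨c0, c1, -, -⟩ := continuous_coords ρ hρ
  obtain ⟨h6, hsw⟩ := im00_six_and_swap ρ hρ
  refine integral_four_two_of_rotations c0 c1 ?_ ?_ h6 hsw
  · have h := integral_comp_quat ρ hρ (a := 3 / 5) (b := 4 / 5) (c := 0) (d := 0) (by norm_num)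
      (fun s _ _ _ => s ^ 6)
    have hpt : ∀ g : G, ((3 / 5 : ℝ) * (ρ g 0 0).re - 4 / 5 * (ρ g 0 0).im - 0 * (ρ g 0 1).re - 0 * (ρ g 0 1).im) ^ 6
        = ((3 * (ρ g 0 0).re - 4 * (ρ g 0 0).im) / 5) ^ 6 := fun g => by ring
    simp only [hpt] at h
    exact h
  · have h := integral_comp_quat ρ hρ (a := 3 / 5) (b := -(4 / 5)) (c := 0) (d := 0) (by norm_num)
      (fun s _ _ _ => s ^ 6)
    have hpt : ∀ g : G,
        ((3 / 5 : ℝ) * (ρ g 0 0).re - -(4 / 5) * (ρ g 0 0).im - 0 * (ρ g 0 1).re - 0 * (ρ g 0 1).im) ^ 6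
        = ((3 * (ρ g 0 0).re + 4 * (ρ g 0 0).im) / 5) ^ 6 := fun g => by ring
    simp only [hpt] at h
    exact h

/-- `∫ (Re U₀₀)⁴ (Re U₀₁)² = (∫ (Re U₀₀)⁶)/5` (rotations by `(3 ± 4j)/5`). [folklore] -/
theorem integral_re00_four_mul_re01_sq (hρ : IsSpecialUnitaryModel ρ) :
    ∫ g, (ρ g 0 0).re ^ 4 * (ρ g 0 1).re ^ 2 ∂haarProbability G =
      (∫ g, (ρ g 0 0).re ^ 6 ∂haarProbability G) / 5 := by
  obtain ⟨c0, -, c2, -⟩ := continuous_coords ρ hρ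
  obtain ⟨h6, hsw⟩ := re01_six_and_swap ρ hρ
  refine integral_four_two_of_rotations c0 c2 ?_ ?_ h6 hsw
  · have h := integral_comp_quat ρ hρ (a := 3 / 5) (b := 0) (c := 4 / 5) (d := 0) (by norm_num)
      (fun s _ _ _ => s ^ 6)
    have hpt : ∀ g : G, ((3 / 5 : ℝ) * (ρ g 0 0).re - 0 * (ρ g 0 0).im - 4 / 5 * (ρ g 0 1).re - 0 * (ρ g 0 1).im) ^ 6
        = ((3 * (ρ g 0 0).re - 4 * (ρ g 0 1).re) / 5) ^ 6 := fun g => by ring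
    simp only [hpt] at h
    exact h
  · have h := integral_comp_quat ρ hρ (a := 3 / 5) (b := 0) (c := -(4 / 5)) (d := 0) (by norm_num)
      (fun s _ _ _ => s ^ 6)
    have hpt : ∀ g : G,
        ((3 / 5 : ℝ) * (ρ g 0 0).re - 0 * (ρ g 0 0).im - -(4 / 5) * (ρ g 0 1).re - 0 * (ρ g 0 1).im) ^ 6
        = ((3 * (ρ g 0 0).re + 4 * (ρ g 0 1).re) / 5) ^ 6 := fun g => by ring
    simp only [hpt] at h
    exact h

/-- `∫ (Re U₀₀)⁴ (Im U₀₁)² = (∫ (Re U₀₀)⁶)/5` (rotations by `(3 ± 4k)/5`). [folklore] -/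
theorem integral_re00_four_mul_im01_sq (hρ : IsSpecialUnitaryModel ρ) :
    ∫ g, (ρ g 0 0).re ^ 4 * (ρ g 0 1).im ^ 2 ∂haarProbability G =
      (∫ g, (ρ g 0 0).re ^ 6 ∂haarProbability G) / 5 := by
  obtain ⟨c0, -, -, c3⟩ := continuous_coords ρ hρ
  obtain ⟨h6, hsw⟩ := im01_six_and_swap ρ hρ
  refine integral_four_two_of_rotations c0 c3 ?_ ?_ h6 hsw
  · have h := integral_comp_quat ρ hρ (a := 3 / 5) (b := 0) (c := 0) (d := 4 / 5) (by norm_num)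
      (fun s _ _ _ => s ^ 6)
    have hpt : ∀ g : G, ((3 / 5 : ℝ) * (ρ g 0 0).re - 0 * (ρ g 0 0).im - 0 * (ρ g 0 1).re - 4 / 5 * (ρ g 0 1).im) ^ 6
        = ((3 * (ρ g 0 0).re - 4 * (ρ g 0 1).im) / 5) ^ 6 := fun g => by ring
    simp only [hpt] at h
    exact h
  · have h := integral_comp_quat ρ hρ (a := 3 / 5) (b := 0) (c := 0) (d := -(4 / 5)) (by norm_num)
      (fun s _ _ _ => s ^ 6)
    have hpt : ∀ g : G,
        ((3 / 5 : ℝ) * (ρ g 0 0).re - 0 * (ρ g 0 0).im - 0 * (ρ g 0 1).re - -(4 / 5) * (ρ g 0 1).im) ^ 6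
        = ((3 * (ρ g 0 0).re + 4 * (ρ g 0 1).im) / 5) ^ 6 := fun g => by ring
    simp only [hpt] at h
    exact h

/-! ### The sixth moment -/

/-- ★ **THE HAAR SIXTH MOMENT OF AN `SU(2)` ENTRY: `∫ (Re ρ(g)₀₀)⁶ dg = 5/64`** — the sixth moment of a coordinate of a
uniform point on `S³` (`E[u₀⁶] = 15/(n(n+2)(n+4)) = 5/64` for `n = 4`). [folklore] -/
theorem integral_re00_pow_six (hρ : IsSpecialUnitaryModel ρ) :
    ∫ g, (ρ g 0 0).re ^ 6 ∂haarProbability G = 5 / 64 := by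
  obtain ⟨c0, c1, c2, c3⟩ := continuous_coords ρ hρ
  -- integrate `x₀⁴ · (x₀² + x₁² + x₂² + x₃²) = x₀⁴`
  have hpt : ∀ g : G, (ρ g 0 0).re ^ 4 =
      (ρ g 0 0).re ^ 6 + (ρ g 0 0).re ^ 4 * (ρ g 0 0).im ^ 2 + (ρ g 0 0).re ^ 4 * (ρ g 0 1).re ^ 2 +
        (ρ g 0 0).re ^ 4 * (ρ g 0 1).im ^ 2 := by
    intro g
    have h1 := sum_sq_eq_one ρ hρ g
    linear_combination -((ρ g 0 0).re ^ 4 * h1)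
  have hq : ∫ g, ((ρ g 0 0).re ^ 6 + (ρ g 0 0).re ^ 4 * (ρ g 0 0).im ^ 2 + (ρ g 0 0).re ^ 4 * (ρ g 0 1).re ^ 2 +
      (ρ g 0 0).re ^ 4 * (ρ g 0 1).im ^ 2) ∂haarProbability G = 1 / 8 := by
    rw [← integral_re00_pow_four ρ hρ]
    exact integral_congr_ae (Filter.Eventually.of_forall fun g => (hpt g).symm)
  have hi1 : Integrable (fun g => (ρ g 0 0).re ^ 6) (haarProbability G) :=
    Continuous.integrable_of_hasCompactSupport (by fun_prop) (HasCompactSupport.of_compactSpace _)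
  have hi2 : Integrable (fun g => (ρ g 0 0).re ^ 4 * (ρ g 0 0).im ^ 2) (haarProbability G) :=
    Continuous.integrable_of_hasCompactSupport (by fun_prop) (HasCompactSupport.of_compactSpace _)
  have hi3 : Integrable (fun g => (ρ g 0 0).re ^ 4 * (ρ g 0 1).re ^ 2) (haarProbability G) :=
    Continuous.integrable_of_hasCompactSupport (by fun_prop) (HasCompactSupport.of_compactSpace _)
  have hi4 : Integrable (fun g => (ρ g 0 0).re ^ 4 * (ρ g 0 1).im ^ 2) (haarProbability G) :=
    Continuous.integrable_of_hasCompactSupport (by fun_prop) (HasCompactSupport.of_compactSpace _)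
  have hi12 : Integrable (fun g => (ρ g 0 0).re ^ 6 + (ρ g 0 0).re ^ 4 * (ρ g 0 0).im ^ 2) (haarProbability G) :=
    hi1.add hi2
  have hi123 : Integrable (fun g => (ρ g 0 0).re ^ 6 + (ρ g 0 0).re ^ 4 * (ρ g 0 0).im ^ 2 +
      (ρ g 0 0).re ^ 4 * (ρ g 0 1).re ^ 2) (haarProbability G) := hi12.add hi3
  rw [integral_add hi123 hi4, integral_add hi12 hi3, integral_add hi1 hi2,
    integral_re00_four_mul_im00_sq ρ hρ, integral_re00_four_mul_re01_sq ρ hρ, integral_re00_four_mul_im01_sq ρ hρ] at hq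
  linarith

/-- ★★ **THE HAAR SIXTH MOMENT OF THE `SU(2)` CHARACTER: `∫ (Re tr ρ(g))⁶ dg = 5`** for every compact group `G ≅ SU(2)` —
the Catalan number `C₃`, the number of invariants in `V^{⊗6}`. [folklore] -/
theorem integral_reTr_pow_six (hρ : IsSpecialUnitaryModel ρ) :
    ∫ g, PlaquetteLowerBound.reTr ρ g ^ 6 ∂haarProbability G = 5 := by
  simp_rw [reTr_eq_two_mul ρ hρ, mul_pow]
  rw [integral_const_mul, integral_re00_pow_six ρ hρ]
  norm_num

/-- ★ `∫ (½ Re tr ρ(g))⁶ dg = 5/64` — the Haar sixth moment of the plaquette variable `W = ½ Re tr U`. [folklore] -/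
theorem integral_half_reTr_pow_six (hρ : IsSpecialUnitaryModel ρ) :
    ∫ g, ((2 : ℝ)⁻¹ * PlaquetteLowerBound.reTr ρ g) ^ 6 ∂haarProbability G = 5 / 64 := by
  simp_rw [mul_pow]
  rw [integral_const_mul, integral_reTr_pow_six ρ hρ]
  norm_num

/-- **The odd moments vanish: `∫ (Re tr ρ(g))⁵ dg = 0`** (centre twist by `−1`). [folklore] -/
theorem integral_reTr_pow_five (hρ : IsSpecialUnitaryModel ρ) :
    ∫ g, PlaquetteLowerBound.reTr ρ g ^ 5 ∂haarProbability G = 0 := by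
  have h := integral_comp_quat ρ hρ (a := -1) (b := 0) (c := 0) (d := 0) (by norm_num) (fun s _ _ _ => (2 * s) ^ 5)
  have hpt : ∀ g : G, (2 * ((-1 : ℝ) * (ρ g 0 0).re - 0 * (ρ g 0 0).im - 0 * (ρ g 0 1).re - 0 * (ρ g 0 1).im)) ^ 5 =
      -((2 * (ρ g 0 0).re) ^ 5) := fun g => by ring
  simp only [hpt, integral_neg] at h
  simp_rw [reTr_eq_two_mul ρ hρ]
  linarith

/-- ★ **The sixth CUMULANT of the `SU(2)` plaquette variable at `β = 0`**: with the moments `m₂ = 1/4`, `m₄ = 1/8`, `m₆ = 5/64` of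
`W = ½ Re tr U` (odd moments zero), `κ₆ = m₆ − 15 m₄ m₂ + 30 m₂³ = 5/64 − 15/32 + 15/32 = 5/64`. [folklore] -/
theorem sixthCumulant_half_reTr (hρ : IsSpecialUnitaryModel ρ) :
    (∫ g, ((2 : ℝ)⁻¹ * PlaquetteLowerBound.reTr ρ g) ^ 6 ∂haarProbability G) -
        15 * (∫ g, ((2 : ℝ)⁻¹ * PlaquetteLowerBound.reTr ρ g) ^ 4 ∂haarProbability G) *
          (∫ g, ((2 : ℝ)⁻¹ * PlaquetteLowerBound.reTr ρ g) ^ 2 ∂haarProbability G) +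
      30 * (∫ g, ((2 : ℝ)⁻¹ * PlaquetteLowerBound.reTr ρ g) ^ 2 ∂haarProbability G) ^ 3 = 5 / 64 := by
  have h2 : ∫ g, ((2 : ℝ)⁻¹ * PlaquetteLowerBound.reTr ρ g) ^ 2 ∂haarProbability G = 1 / 4 := by
    simp_rw [mul_pow]
    rw [integral_const_mul]
    have hV := RobustBall.HaarSecondMoments.charVariance_eq_one ρ hρ
    unfold PlaquetteLowerBound.charVariance at hV
    rw [hV]; norm_num
  rw [integral_half_reTr_pow_six ρ hρ, HaarFourthMoment.integral_half_reTr_pow_four ρ hρ, h2]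
  norm_num

end Model

/-! ### The concrete group `SU(2) = Matrix.specialUnitaryGroup (Fin 2) ℂ` -/

/-- ★★ **`∫_{SU(2)} (Re tr U)⁶ dU = 5`** in the venture's vocabulary (`fundamentalRep (Fin 2)`). [folklore] -/
theorem integral_reTr_pow_six_su2 :
    ∫ U, ((U : Matrix (Fin 2) (Fin 2) ℂ).trace.re) ^ 6 ∂haarProbability (Matrix.specialUnitaryGroup (Fin 2) ℂ) = 5 := by
  have h := integral_reTr_pow_six (fundamentalRep (Fin 2)) (TorusAreaLaw.isSpecialUnitaryModel_fundamentalRep 2)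
  simpa only [PlaquetteLowerBound.reTr, fundamentalRep_apply] using h

/-- ★ **`∫_{SU(2)} (½ Re tr U)⁶ dU = 5/64`.** [folklore] -/
theorem integral_half_reTr_pow_six_su2 :
    ∫ U, ((2 : ℝ)⁻¹ * (U : Matrix (Fin 2) (Fin 2) ℂ).trace.re) ^ 6 ∂haarProbability (Matrix.specialUnitaryGroup (Fin 2) ℂ) =
      5 / 64 := by
  have h := integral_half_reTr_pow_six (fundamentalRep (Fin 2)) (TorusAreaLaw.isSpecialUnitaryModel_fundamentalRep 2)
  simpa only [PlaquetteLowerBound.reTr, fundamentalRep_apply] using h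

/-- **`∫_{SU(2)} (Re tr U)⁵ dU = 0`.** [folklore] -/
theorem integral_reTr_pow_five_su2 :
    ∫ U, ((U : Matrix (Fin 2) (Fin 2) ℂ).trace.re) ^ 5 ∂haarProbability (Matrix.specialUnitaryGroup (Fin 2) ℂ) = 0 := by
  have h := integral_reTr_pow_five (fundamentalRep (Fin 2)) (TorusAreaLaw.isSpecialUnitaryModel_fundamentalRep 2)
  simpa only [PlaquetteLowerBound.reTr, fundamentalRep_apply] using h

end Summit.Ventures.YMGap.HaarSixthMoment
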